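import Summits.AtomisticToContinuum.FouriersLaw.Theorems.BondHeatUncertaintyExtensiveSnapshotIrreversibilityCorrectorIntegrability
import Summits.AtomisticToContinuum.FouriersLaw.Theorems.ExtensiveSnapshotIrreversibility.Negative.DegenerateInstances
import HarnessLib

/-!
# Crux `ExtensiveSnapshotIrreversibility` (stmt-AtomisticToContinuum-9121), line `clausius-budget-sound-window`:
the late-odd-response stub S4 from the ODD CORRECTOR BOUND (c3 lead's reshaping S4f → S4o)

The derived stub S4 `stub_lateOddResponse` of the line (for some `τ ≤ cN`, `P_τ w ∈ L²(μ_T)` and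
`∫ (P_τ w − (P_τ w)∘Θ)² dμ_T ≤ C·N`) follows AT `τ = 0` from the odd-sector bound on the McLennan corrector
`w = ∫₀^∞ P_s g ds` itself: `∫ (w − w∘Θ)² dμ_T ≤ C'·N` for all `N ≥ 2` (stub S4o `stub_oddCorrectorBound` of the
c3 skeleton). Given the fixed-`N` second-order expansion `KL(μ_δ ‖ Θ_*μ_δ) = ½δ²∫(w − w∘Θ)² dμ_T + o(δ²)` (stubs S1a–S1d
of the line), S4o is EXACTLY the `N`-uniform content of the crux (necessary and sufficient), whereas the earlier S4f
(`∫ w² dμ_T ≤ C·N`, extensive Fisher information, `lateOddResponse_of_extensiveFisher` p91965) is sufficient only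
(it also bounds the even sector). Proof: `P_0 = id` (`pinnedChain_transitionKernel_zero`), `w ∈ L²(μ_T)` from the
landed S2a `stub_correctorIntegrability`; take `c = 1`, `τ = 0`, `C = max C' 0`.
-/

noncomputable section

namespace Summit.AtomisticToContinuum.FouriersLaw.Theorems.ExtensiveSnapshotIrreversibility.ClausiusBudget

open MeasureTheory Filter Topology
open scoped ENNReal NNReal
open Literature.MathematicalPhysics.KineticTheory.HeatConduction

/-- **S4 from the odd corrector bound** (c3 lead, 2026-08-16): if the McLennan corrector satisfies
`∫ (w − w∘Θ)² dμ_T ≤ C'·N` for all `N ≥ 2`, then the late-odd-response statement S4 holds with `c = 1`, `τ = 0`,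
`C = max C' 0` (`P_0 w = w` pointwise, `w ∈ L²(μ_T)` by S2a). [folklore] -/
theorem lateOddResponse_of_oddCorrectorBound :
    ∀ ω₂ lam β γ : ℝ, 0 < ω₂ → 0 < lam → 0 < β → 0 < γ →
      (∀ (N : ℕ) (T_L T_R : ℝ), 0 < T_L → 0 < T_R → ∀ μ ν : Measure (PhaseSpace N),
        (pinnedChain ω₂ lam β γ).IsSteadyState N T_L T_R μ →
        (pinnedChain ω₂ lam β γ).IsSteadyState N T_L T_R ν → μ = ν) →
      ∀ T : ℝ, 0 < T → (∃ C' : ℝ, ∀ (N : ℕ) (hN : 2 ≤ N),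
        let P := pinnedChain ω₂ lam β γ
        let μT := P.gibbsMeasure N T
        let g : PhaseSpace N → ℝ := fun y =>
          γ / (2 * T ^ 2) * (y.2 ⟨0, by omega⟩ ^ 2 - y.2 ⟨N - 1, by omega⟩ ^ 2)
        let Pg : ℝ → PhaseSpace N → ℝ := fun s z => ∫ y, g y ∂(P.transitionKernel N T T s.toNNReal z)
        let w : PhaseSpace N → ℝ := fun z => ∫ s in Set.Ioi (0 : ℝ), Pg s z
        ∫ z, (w z - w (z.1, -z.2)) ^ 2 ∂μT ≤ C' * N) →
      ∃ C c : ℝ, 0 < c ∧ ∀ (N : ℕ) (hN : 2 ≤ N),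
        let P := pinnedChain ω₂ lam β γ
        let μT := P.gibbsMeasure N T
        (∀ t : ℝ≥0, μT.bind (P.transitionKernel N T T t) = μT) →
        (∀ ϑ : ℝ, 0 < ϑ → ϑ < 1 / T → ∃ C c : ℝ, 0 < C ∧ 0 < c ∧
          ∀ (z : PhaseSpace N) (t : ℝ≥0) (f : PhaseSpace N → ℝ), Continuous f →
            (∀ y, |f y| ≤ Real.exp (ϑ * P.hamiltonian N y)) →
            |(∫ y, f y ∂(P.transitionKernel N T T t z)) - ∫ y, f y ∂μT| ≤
              C * Real.exp (ϑ * P.hamiltonian N z) * Real.exp (-c * t)) →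
        let g : PhaseSpace N → ℝ := fun y =>
          γ / (2 * T ^ 2) * (y.2 ⟨0, by omega⟩ ^ 2 - y.2 ⟨N - 1, by omega⟩ ^ 2)
        let Pg : ℝ → PhaseSpace N → ℝ := fun s z => ∫ y, g y ∂(P.transitionKernel N T T s.toNNReal z)
        let w : PhaseSpace N → ℝ := fun z => ∫ s in Set.Ioi (0 : ℝ), Pg s z
        let Pw : ℝ → PhaseSpace N → ℝ := fun τ z => ∫ x, w x ∂(P.transitionKernel N T T τ.toNNReal z)
        ∃ τ : ℝ, 0 ≤ τ ∧ τ ≤ c * N ∧ MemLp (Pw τ) 2 μT ∧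
          ∫ z, (Pw τ z - Pw τ (z.1, -z.2)) ^ 2 ∂μT ≤ C * N := by
  intro ω₂ lam β γ hω hl hβ hγ _hU T hT hOdd
  obtain ⟨C', hC'⟩ := hOdd
  refine ⟨max C' 0, 1, one_pos, fun N hN => ?_⟩
  intro P μT hInv hMix g Pg w Pw
  -- `w ∈ L²(μ_T)` from the landed S2a
  obtain ⟨-, hw2, -⟩ := stub_correctorIntegrability ω₂ lam β γ hω hl hβ hγ T hT N hN hInv hMix
  have hON : ∫ z, (w z - w (z.1, -z.2)) ^ 2 ∂μT ≤ C' * N := hC' N hN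
  -- `P_0 w = w`
  have hP0 : ∀ z, Pw 0 z = w z := by
    intro z
    show ∫ x, w x ∂(P.transitionKernel N T T (Real.toNNReal 0) z) = w z
    rw [Real.toNNReal_zero, pinnedChain_transitionKernel_zero hω hl.le hβ.le hγ.le N T T,
      ProbabilityTheory.Kernel.id_apply, integral_dirac]
  have hPw0 : Pw 0 = w := funext hP0
  have hN0 : (0 : ℝ) ≤ N := by positivity
  refine ⟨0, le_rfl, by positivity, ?_, ?_⟩
  · rw [hPw0]; exact hw2
  · rw [hPw0]
    calc ∫ z, (w z - w (z.1, -z.2)) ^ 2 ∂μT ≤ C' * N := hON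
      _ ≤ max C' 0 * N := mul_le_mul_of_nonneg_right (le_max_left C' 0) hN0

end Summit.AtomisticToContinuum.FouriersLaw.Theorems.ExtensiveSnapshotIrreversibility.ClausiusBudget

end
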